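import Literature.Topology.FourManifolds.HCobordismDonaldson
import Literature.Topology.FourManifolds.IntersectionFormTopology
import Literature.Topology.FourManifolds.LatticeFormsDefinite
import Literature.Topology.FourManifolds.LatticeFormsIndefiniteProofs
import Literature.AlgebraicTopology.SingularHomology.CupProductProofs
import Literature.AlgebraicTopology.SingularHomology.CohomologyFiniteness
import HarnessLib

/-!
# Towards `exists_homeomorph_isEmpty_diffeomorph_four_holds`: Donaldson's exotic pair `(Y, Z)`,
# the classical assembly PROVED, the gauge-theoretic leaf as explicit hypotheses

Sibling proof file of `HCobordismDonaldson.lean` for the named fact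
`Literature.Topology.FourManifolds.exists_homeomorph_isEmpty_diffeomorph_four` (there are simply
connected closed smooth 4-manifolds which are homeomorphic but not diffeomorphic; S. K. Donaldson,
*Irrationality and the h-cobordism conjecture*, J. Differential Geom. 26 (1987) 141–168,
Prop. (3.16)(ii) p. 159 and Thm. (3.24) p. 163, in `∃`-form). Provefact triage **XL**: an
unconditional proof is a formal construction of two closed smooth simply connected 4-manifolds, a
homeomorphism between them (in print always Freedman's classification) and a PROOF that they are
not diffeomorphic (in print always gauge theory: Donaldson's `Γ`-invariant here, Seiberg–Witten
invariants for the later small exotica) — theories absent from Mathlib and from the tree. This file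
PROVES, sorry-free, the classical step of the printed proof — the sentence "So the assertions
follow (using the classification of forms [28] and the theorems of Milnor [21], Wall [29], and
Freedman [11])" of p. 160, with [28] PROVED in the tree and Wall's Thm. 2 / Freedman's h-cobordism
theorem entering as the tree's named facts (hypotheses `hW`, `hF`) — and states the assembly with
the gauge-theoretic input (what Donaldson's paper itself proves about the pair `(Y, Z)`: the
printed invariants and the non-diffeomorphism) as EXPLICIT HYPOTHESES of the assembly theorems,
not as a named fact.

**2026-08-15, review of the split (D-0026/D-0027).** The first version of this file cut the parent
fact along the printed proof into three classical tree facts and ONE new named fact,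
`donaldson1987_dolgachev_invariants` (Prop. (3.16)(ii)'s proof and Thm. (3.24) as printed: simply
connected closed smooth `Y`, `Z` with odd intersection forms of type `(1, 9)`, not diffeomorphic).
Its prove-seat triaged that child **XL** as well — it carries the parent's ENTIRE non-classical
content (the rational elliptic surface `Y = ℂℙ² # 9ℂℙ²bar` with `Q_Y = ⟨1⟩ ⊕ 9⟨-1⟩`, the Dolgachev
surface `Z` by logarithmic transformation with Kodaira's `π₁` computation, and the `Γ`-invariant of
Thm. (2.15)) — and audited it faithful. A child as hard as its parent is not a cut: decompositions
of facts do not recurse, so the child was MERGED BACK into the parent's proof obligation. The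
named fact is gone; its content survives verbatim as the binders
`(Y Z : Type) … (μ ν) (hμ hν : type (1, 9), odd) (hne : IsEmpty (Y ≃ₘ⟮𝓡 4, 𝓡 4⟯ Z))` of the §3
assemblies, which is exactly what a discharge `exists_homeomorph_isEmpty_diffeomorph_four_holds`
along Donaldson's own source has to construct. At the same time the unimodularity hypothesis `hU`
of the assemblies was discharged: for closed 4-manifolds it is now the tree's THEOREM
`isPerfPair_intersectionForm_four_of_compactSpace` (`IntersectionFormTopology.lean`; Hatcher 2002,
Prop. 3.38, from Poincaré duality, universal coefficients and finiteness, all proved).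

## The printed proof (Donaldson 1987, §III(b)(i), pp. 159–160 and p. 163)

`Y` is `ℂℙ²` blown up in the nine base points of a general cubic pencil: "from its definition `Y`
is a rational surface and the underlying smooth oriented 4-manifold is the connected sum
`ℂℙ² # 9ℂℙ²bar`" (p. 159), so `Q_Y = ⟨1⟩ ⊕ 9⟨-1⟩` is odd of type `(1, 9)` (`b⁺ = 1`, `b⁻ = 9`;
§II(a): "intersection form has type `(1, n)`"). `Z` is Dolgachev's surface (logarithmic
transformations of multiplicities `2, 3` on two smooth fibres of `Y → ℂℙ¹`). Prop. (3.16)(ii):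
"The 4-manifold underlying `Z` is simply connected and homotopy equivalent, smoothly h-cobordant
and homeomorphic to that underlying `Y`." Its proof (p. 160): `Z` is simply connected (Kodaira
[19]); "since `K_Z` is nonzero in `H²(Z, ℤ/2)` and represents `w₂(Z)`, the intersection form of
`Z` is odd. So the assertions follow (using the classification of forms [28] and the theorems of
Milnor [21], Wall [29], and Freedman [11]) if we show that `Z` has an intersection form of type
`(1, 9)`" — which the Hodge index formula (`b⁺ = 1 + 2p_g = 1`) and Noether's formula
(`c₂(Z) = 12`, `b₂(Z) = 10`) give. Thm. (3.24), p. 163: "The Dolgachev surface `Z` is not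
diffeomorphic to the rational surface `Y`" (the chamber invariants of Thm. (2.15):
`Γ_Y(C_Y) · ω < 0 < Γ_Z(C_Z) · ω`, using Wall [30, Thm. 2] to align the chambers). Any
diffeomorphism is excluded: one reversing the complex orientations would give `Q_Y ≅ -Q_Z` of
type `(9, 1)`, impossible, so `IsEmpty (Y ≃ₘ⟮𝓡 4, 𝓡 4⟯ Z)` renders Thm. (3.24) unambiguously.

## What is here

* §1 PROVED lattice bookkeeping for a closed `ℤ`-oriented 4-manifold `(M, μ)` whose form has type
  `(p, n)` (`sigPos = p`, `sigNeg = n`, Mathlib's root-level `sigPos`/`sigNeg`), GIVEN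
  unimodularity as a hypothesis `hU : isPerfPair_intersectionForm_four (M := M)` (the legacy
  predicate; TRUE for every closed `M`, `isPerfPair_intersectionForm_four_of_compactSpace`, which
  is how §3 feeds it): `rank H²(M; ℤ)/T = p + n` (Sylvester over `ℤ`, the tree's
  `sigPos_add_sigNeg_eq_finrank_holds`), `σ(M, μ) = p - n` (definitional), indefinite when
  `p, n > 0` (`isIndefinite_iff_sigPos_pos_and_sigNeg_pos_of_isUnimodular`), and — "the
  classification of forms [28]" — two such forms of the same indefinite type and the same parity
  are isometric (`equivalent_intersectionForm_of_type_eq`), by Serre's Ch. V Thm. 6, PROVED in the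
  tree (`LinearMap.BilinForm.equivalent_of_isIndefinite_holds`, Hasse–Minkowski included). Symmetry
  of `Q_M`: the tree's named fact `isSymm_intersectionForm_four` (`IntersectionFormTopology.lean`)
  is DISCHARGED here, `isSymm_intersectionForm_four_holds`, from the proved
  `cupProduct_gradedComm_holds`; finiteness/freeness of `H²/T` are `finite_freeCohomology`,
  `free_freeCohomology` over the proved `finite_singularCohomology_of_compactSpace_of_isPrincipalIdealRing`.
* §2 PROVED, the sentence "So the assertions follow (using [28], Milnor, Wall, Freedman)":
  GIVEN `hU` and Wall's Thm. 2 (`isHCobordant_of_equivalent_intersectionForm`, `hW`) two simply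
  connected closed smooth 4-manifolds with odd forms of type `(1, 9)` are smoothly h-cobordant
  (`isHCobordant_of_typeOneNine`), and GIVEN moreover Freedman's h-cobordism theorem
  (`nonempty_homeomorph_of_isHCobordant_four`, `hF`) homeomorphic (`nonempty_homeomorph_of_typeOneNine`).
* §3 PROVED assemblies FROM THE LEAF DATA — simply connected closed smooth `Y`, `Z` in `Type`,
  `ℤ`-orientations `μ`, `ν` with odd forms of type `(1, 9)`, and `IsEmpty (Y ≃ₘ⟮𝓡 4, 𝓡 4⟯ Z)`,
  all as binders: `exists_homeomorph_isEmpty_diffeomorph_four_of_donaldson1987`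
  (`hW → hF → data → exists_homeomorph_isEmpty_diffeomorph_four`) and — Donaldson's own
  counterexample statement, p. 142, which needs NO Freedman —
  `exists_isHCobordant_isEmpty_diffeomorph_four_of_donaldson1987`
  (`hW → data → exists_isHCobordant_isEmpty_diffeomorph_four`, the tree's **spc4.S16**), and both
  packaged (`exists_isHCobordant_and_exists_homeomorph_of_donaldson1987`). No `hU` any more.

Resulting trust base of `exists_homeomorph_isEmpty_diffeomorph_four` along its OWN cited source
(all arrows proved here): Wall 1964 Thm. 2, Freedman 1982 Thm. 1.3, and the leaf data. What an
unconditional `exists_homeomorph_isEmpty_diffeomorph_four_holds` still needs is a discharge of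
each: `Ω₄^{SO} ≅ ℤ` with 5-dimensional handle trading (Wall), Casson handles / Bing shrinking
(Freedman), and the Dolgachev surface with Donaldson's `Γ`-invariant — or any other exotic pair
with its gauge-theoretic invariant, e.g. through the alternative leaf
`exists_homeomorph_isEmpty_diffeomorph_four_of_akhmedovPark` of `HCobordismDonaldson.lean` — for
the data. Nothing in `HCobordismDonaldson.lean` is restated or changed.

## References

[DonaldsonIrrationality1987] [WallJLMS1964] [FreedmanJDG1982] [Serre1973] [MilnorHusemoller1973]
[HatcherAT2002]
-/

noncomputable section

open scoped Manifold ContDiff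
open LinearMap.BilinForm
open Literature.AlgebraicTopology.SingularHomology (HomologicalOrientation freeCohomology
  intersectionForm isSymm_intersectionForm cupProduct_gradedComm_holds finite_freeCohomology
  free_freeCohomology finite_singularCohomology_of_compactSpace_of_isPrincipalIdealRing)

universe u

namespace Literature.Topology.FourManifolds

/-- Local notation: `𝔼 n` is the model Euclidean space `EuclideanSpace ℝ (Fin n)`. -/
local notation "𝔼 " n:arg => EuclideanSpace ℝ (Fin n)

/-- Local notation: `Q⟦μ⟧` is the intersection form
`Literature.AlgebraicTopology.SingularHomology.intersectionForm two_add_two_eq_four μ` on `H²(M; ℤ)/T` of the closed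
`ℤ`-oriented topological 4-manifold `(M, μ)` (as in `HCobordismDonaldson.lean`). -/
local notation "Q⟦" μ "⟧" =>
  Literature.AlgebraicTopology.SingularHomology.intersectionForm two_add_two_eq_four μ

/-! ### §1 Closed oriented 4-manifolds with intersection form of type `(p, n)` -/

section TypePN

variable {M : Type u} [TopologicalSpace M] [T2Space M] [ChartedSpace (𝔼 4) M] [CompactSpace M]

omit [T2Space M] [ChartedSpace (𝔼 4) M] [CompactSpace M] in
/-- **The intersection form of a `ℤ`-oriented 4-manifold is symmetric — discharge of the tree's
named fact `isSymm_intersectionForm_four`** (`IntersectionFormTopology.lean`, spc4.S08 symmetry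
part; Milnor–Husemoller 1973, §V.1; Gompf–Stipsicz 1999, §1.2, Def. 1.2.1): `k = 2` is even, so
G04's `isSymm_intersectionForm` applies once fed with the PROVED graded commutativity of the cup
product `cupProduct_gradedComm_holds` (Hatcher Thm. 3.11) — exactly the interim proof preserved in
that file. No manifold hypothesis is needed. [cite: MilnorHusemoller1973, §V.1] -/
theorem isSymm_intersectionForm_four_holds : isSymm_intersectionForm_four.{u} := by
  intro X _ μ
  exact isSymm_intersectionForm (cupProduct_gradedComm_holds ℤ X) ⟨1, rfl⟩ two_add_two μ

omit [T2Space M] [ChartedSpace (𝔼 4) M] [CompactSpace M] in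
/-- Symmetry of `Q⟦μ⟧ = intersectionForm two_add_two_eq_four μ` (the degree equation used in this
file and in `HCobordismDonaldson.lean`; any two proofs of `2 + 2 = 4` give the same form), from
`isSymm_intersectionForm_four_holds`. [cite: MilnorHusemoller1973, §V.1] -/
theorem isSymm_intersectionForm_four' (μ : HomologicalOrientation ℤ M 4) : (Q⟦μ⟧).IsSymm :=
  isSymm_intersectionForm_four_holds μ

/-- **`b₂ = b⁺ + b⁻`**: for a closed `ℤ`-oriented 4-manifold with unimodular intersection form
(`hU`, Poincaré duality, the tree fact `isPerfPair_intersectionForm_four`), the rank of the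
lattice `H²(M; ℤ)/T` is `sigPos + sigNeg` of `Q_M` (Milnor–Husemoller 1973, §II.2 and §V.1:
rank, index and the split `r = b⁺ + b⁻` of a nonsingular form; Sylvester over `ℤ` is the tree's
PROVED `sigPos_add_sigNeg_eq_finrank_holds`). [cite: MilnorHusemoller1973, §II.2 and §V.1] -/
theorem finrank_freeCohomology_two_eq_sigPos_add_sigNeg
    (hU : isPerfPair_intersectionForm_four (M := M)) (μ : HomologicalOrientation ℤ M 4) :
    Module.finrank ℤ ↥(freeCohomology ℤ M 2) =
      sigPos (Q⟦μ⟧).toQuadraticMap + sigNeg (Q⟦μ⟧).toQuadraticMap := by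
  haveI := finite_freeCohomology
    (finite_singularCohomology_of_compactSpace_of_isPrincipalIdealRing ℤ M 4 2)
  haveI := free_freeCohomology
    (finite_singularCohomology_of_compactSpace_of_isPrincipalIdealRing ℤ M 4 2)
  exact (sigPos_add_sigNeg_eq_finrank_holds (Q⟦μ⟧) (hU μ) (isSymm_intersectionForm_four' μ)).symm

omit [T2Space M] [ChartedSpace (𝔼 4) M] [CompactSpace M] in
/-- **The signature of a form of type `(p, n)` is `p - n`** (`σ(M, μ) = b⁺ - b⁻`, the tree's
`HomologicalOrientation.signature`; Milnor–Husemoller 1973, §II.2). Definitional bookkeeping.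
[cite: MilnorHusemoller1973, §II.2] -/
theorem signature_eq_sub_of_type (μ : HomologicalOrientation ℤ M 4) {p n : ℕ}
    (hp : sigPos (Q⟦μ⟧).toQuadraticMap = p) (hn : sigNeg (Q⟦μ⟧).toQuadraticMap = n) :
    μ.signature = (p : ℤ) - n := by
  rw [Literature.AlgebraicTopology.SingularHomology.HomologicalOrientation.signature,
    LinearMap.BilinForm.signature, hp, hn]

/-- **A unimodular form of type `(p, n)` with `p, n > 0` is indefinite** (Milnor–Husemoller 1973,
§II.2; in the tree `isIndefinite_iff_sigPos_pos_and_sigNeg_pos_of_isUnimodular`,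
Freedman–Quinn §10.2A), as for Donaldson's forms of type `(1, n)`, `n ≥ 1` (§II(a)).
[cite: MilnorHusemoller1973, §II.2] -/
theorem isIndefinite_intersectionForm_of_type (hU : isPerfPair_intersectionForm_four (M := M))
    (μ : HomologicalOrientation ℤ M 4) {p n : ℕ} (hp0 : 0 < p) (hn0 : 0 < n)
    (hp : sigPos (Q⟦μ⟧).toQuadraticMap = p) (hn : sigNeg (Q⟦μ⟧).toQuadraticMap = n) :
    (Q⟦μ⟧).IsIndefinite := by
  haveI := finite_freeCohomology
    (finite_singularCohomology_of_compactSpace_of_isPrincipalIdealRing ℤ M 4 2)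
  rw [isIndefinite_iff_sigPos_pos_and_sigNeg_pos_of_isUnimodular (isSymm_intersectionForm_four' μ)
    (hU μ), hp, hn]
  exact ⟨hp0, hn0⟩

/-- **"The classification of forms [28]"** (Serre, *A Course in Arithmetic*, Ch. V §2.2 Thm. 6:
indefinite unimodular lattices are classified by rank, signature and type), in the form Donaldson
uses it on p. 160: two closed `ℤ`-oriented 4-manifolds (in one universe) with unimodular
intersection forms (`hUM`, `hUN`) of the SAME type `(p, n)` with `p, n > 0` and the same parity
have isometric intersection forms. Both forms are symmetric (`isSymm_intersectionForm_four'`),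
indefinite (`isIndefinite_intersectionForm_of_type`), of rank `p + n`
(`finrank_freeCohomology_two_eq_sigPos_add_sigNeg`) and signature `p - n`; Serre's theorem is the
tree's PROVED `LinearMap.BilinForm.equivalent_of_isIndefinite_holds`. [cite: Serre1973, Ch. V §2.2 Thm. 6] -/
theorem equivalent_intersectionForm_of_type_eq {N : Type u} [TopologicalSpace N] [T2Space N]
    [ChartedSpace (𝔼 4) N] [CompactSpace N]
    (hUM : isPerfPair_intersectionForm_four (M := M))
    (hUN : isPerfPair_intersectionForm_four (M := N))
    (μ : HomologicalOrientation ℤ M 4) (ν : HomologicalOrientation ℤ N 4) {p n : ℕ}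
    (hp0 : 0 < p) (hn0 : 0 < n)
    (hμp : sigPos (Q⟦μ⟧).toQuadraticMap = p) (hμn : sigNeg (Q⟦μ⟧).toQuadraticMap = n)
    (hνp : sigPos (Q⟦ν⟧).toQuadraticMap = p) (hνn : sigNeg (Q⟦ν⟧).toQuadraticMap = n)
    (htype : (Q⟦μ⟧).IsEven ↔ (Q⟦ν⟧).IsEven) :
    (Q⟦μ⟧).Equivalent (Q⟦ν⟧) := by
  haveI := finite_freeCohomology
    (finite_singularCohomology_of_compactSpace_of_isPrincipalIdealRing ℤ M 4 2)
  haveI := free_freeCohomology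
    (finite_singularCohomology_of_compactSpace_of_isPrincipalIdealRing ℤ M 4 2)
  haveI := finite_freeCohomology
    (finite_singularCohomology_of_compactSpace_of_isPrincipalIdealRing ℤ N 4 2)
  haveI := free_freeCohomology
    (finite_singularCohomology_of_compactSpace_of_isPrincipalIdealRing ℤ N 4 2)
  have hrank : Module.finrank ℤ ↥(freeCohomology ℤ M 2) = Module.finrank ℤ ↥(freeCohomology ℤ N 2) := by
    rw [finrank_freeCohomology_two_eq_sigPos_add_sigNeg hUM μ,
      finrank_freeCohomology_two_eq_sigPos_add_sigNeg hUN ν, hμp, hμn, hνp, hνn]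
  have hsig : (Q⟦μ⟧).signature = (Q⟦ν⟧).signature := by
    change μ.signature = ν.signature
    rw [signature_eq_sub_of_type μ hμp hμn, signature_eq_sub_of_type ν hνp hνn]
  exact equivalent_of_isIndefinite_holds (Q := Q⟦μ⟧) (Q' := Q⟦ν⟧) (isSymm_intersectionForm_four' μ)
    (hUM μ) (isIndefinite_intersectionForm_of_type hUM μ hp0 hn0 hμp hμn)
    (isSymm_intersectionForm_four' ν) (hUN ν)
    (isIndefinite_intersectionForm_of_type hUN ν hp0 hn0 hνp hνn) hrank hsig htype

/-- **Odd forms of type `(1, 9)` on two closed oriented 4-manifolds are isometric** (both are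
`⟨1⟩ ⊕ 9⟨-1⟩ = Q_{ℂℙ² # 9ℂℙ²bar}`; Serre, Ch. V §2.2 Thm. 4 with Thm. 6) — the case of
`equivalent_intersectionForm_of_type_eq` behind Donaldson 1987, Prop. (3.16)(ii): "`Z` has an
intersection form of type `(1, 9)`", odd, like `Y = ℂℙ² # 9ℂℙ²bar`. GIVEN unimodularity.
[cite: Serre1973, Ch. V §2.2 Thms. 4 and 6] -/
theorem equivalent_intersectionForm_of_typeOneNine_of_isOdd {N : Type u} [TopologicalSpace N]
    [T2Space N] [ChartedSpace (𝔼 4) N] [CompactSpace N]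
    (hUM : isPerfPair_intersectionForm_four (M := M))
    (hUN : isPerfPair_intersectionForm_four (M := N))
    (μ : HomologicalOrientation ℤ M 4) (ν : HomologicalOrientation ℤ N 4)
    (hμ : sigPos (Q⟦μ⟧).toQuadraticMap = 1 ∧ sigNeg (Q⟦μ⟧).toQuadraticMap = 9 ∧ (Q⟦μ⟧).IsOdd)
    (hν : sigPos (Q⟦ν⟧).toQuadraticMap = 1 ∧ sigNeg (Q⟦ν⟧).toQuadraticMap = 9 ∧ (Q⟦ν⟧).IsOdd) :
    (Q⟦μ⟧).Equivalent (Q⟦ν⟧) :=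
  equivalent_intersectionForm_of_type_eq hUM hUN μ ν Nat.one_pos (Nat.succ_pos 8) hμ.1 hμ.2.1
    hν.1 hν.2.1 ⟨fun h => absurd h hμ.2.2, fun h => absurd h hν.2.2⟩

/-- **A form of type `(1, 9)` has rank `10` and signature `-8`** (`b₂(Z) = 10`,
`σ(Z) = 1 - 9 = -8`: the numbers Donaldson extracts from Noether's formula `c₂(Z) = 12` and the
Hodge index formula `b⁺ = 1 + 2p_g = 1`, proof of Prop. (3.16)(ii), p. 160), GIVEN
unimodularity for the rank. [cite: DonaldsonIrrationality1987, proof of Prop. (3.16)(ii), p. 160] -/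
theorem finrank_eq_ten_and_signature_eq_of_typeOneNine
    (hU : isPerfPair_intersectionForm_four (M := M)) (μ : HomologicalOrientation ℤ M 4)
    (hp : sigPos (Q⟦μ⟧).toQuadraticMap = 1) (hn : sigNeg (Q⟦μ⟧).toQuadraticMap = 9) :
    Module.finrank ℤ ↥(freeCohomology ℤ M 2) = 10 ∧ μ.signature = -8 := by
  refine ⟨?_, ?_⟩
  · rw [finrank_freeCohomology_two_eq_sigPos_add_sigNeg hU μ, hp, hn]
  · rw [signature_eq_sub_of_type μ hp hn]
    norm_num

end TypePN

/-! ### §2 "So the assertions follow (using [28] and the theorems of Milnor, Wall, Freedman)" -/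

/-- **Simply connected closed smooth 4-manifolds with odd intersection forms of type `(1, 9)` are
smoothly h-cobordant, GIVEN unimodularity (`hU`) and Wall's Thm. 2 (`hW`,
`isHCobordant_of_equivalent_intersectionForm`)** — the "smoothly h-cobordant" clause of
Donaldson 1987, Prop. (3.16)(ii), exactly as derived on p. 160: the forms are isometric by the
classification of forms (`equivalent_intersectionForm_of_typeOneNine_of_isOdd`, Serre Thm. 6
PROVED), hence the manifolds are h-cobordant by Wall [29]. No Freedman needed.
[cite: DonaldsonIrrationality1987, Prop. (3.16)(ii) and its proof, p. 160] -/
theorem isHCobordant_of_typeOneNine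
    (hU : ∀ (M : Type) [TopologicalSpace M] [T2Space M] [ChartedSpace (𝔼 4) M] [CompactSpace M],
      isPerfPair_intersectionForm_four (M := M))
    (hW : isHCobordant_of_equivalent_intersectionForm)
    (M N : Type) [TopologicalSpace M] [T2Space M] [SecondCountableTopology M]
    [ChartedSpace (𝔼 4) M] [CompactSpace M] [IsManifold (𝓡 4) ∞ M] [SimplyConnectedSpace M]
    [TopologicalSpace N] [T2Space N] [SecondCountableTopology N] [ChartedSpace (𝔼 4) N]
    [CompactSpace N] [IsManifold (𝓡 4) ∞ N] [SimplyConnectedSpace N]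
    (μ : HomologicalOrientation ℤ M 4) (ν : HomologicalOrientation ℤ N 4)
    (hμ : sigPos (Q⟦μ⟧).toQuadraticMap = 1 ∧ sigNeg (Q⟦μ⟧).toQuadraticMap = 9 ∧ (Q⟦μ⟧).IsOdd)
    (hν : sigPos (Q⟦ν⟧).toQuadraticMap = 1 ∧ sigNeg (Q⟦ν⟧).toQuadraticMap = 9 ∧ (Q⟦ν⟧).IsOdd) :
    IsHCobordant 4 M N :=
  hW M N μ ν (equivalent_intersectionForm_of_typeOneNine_of_isOdd (hU M) (hU N) μ ν hμ hν)

/-- **… and homeomorphic, GIVEN moreover Freedman's h-cobordism theorem (`hF`,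
`nonempty_homeomorph_of_isHCobordant_four`)** — the "homeomorphic" clause of Prop. (3.16)(ii)
("by Freedman's classification [11] the two manifolds are homeomorphic", p. 142), through
`isHCobordant_of_typeOneNine`. [cite: DonaldsonIrrationality1987, Prop. (3.16)(ii), p. 159, with p. 142] -/
theorem nonempty_homeomorph_of_typeOneNine
    (hU : ∀ (M : Type) [TopologicalSpace M] [T2Space M] [ChartedSpace (𝔼 4) M] [CompactSpace M],
      isPerfPair_intersectionForm_four (M := M))
    (hW : isHCobordant_of_equivalent_intersectionForm)
    (hF : nonempty_homeomorph_of_isHCobordant_four.{0})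
    (M N : Type) [TopologicalSpace M] [T2Space M] [SecondCountableTopology M]
    [ChartedSpace (𝔼 4) M] [CompactSpace M] [IsManifold (𝓡 4) ∞ M] [SimplyConnectedSpace M]
    [TopologicalSpace N] [T2Space N] [SecondCountableTopology N] [ChartedSpace (𝔼 4) N]
    [CompactSpace N] [IsManifold (𝓡 4) ∞ N] [SimplyConnectedSpace N]
    (μ : HomologicalOrientation ℤ M 4) (ν : HomologicalOrientation ℤ N 4)
    (hμ : sigPos (Q⟦μ⟧).toQuadraticMap = 1 ∧ sigNeg (Q⟦μ⟧).toQuadraticMap = 9 ∧ (Q⟦μ⟧).IsOdd)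
    (hν : sigPos (Q⟦ν⟧).toQuadraticMap = 1 ∧ sigNeg (Q⟦ν⟧).toQuadraticMap = 9 ∧ (Q⟦ν⟧).IsOdd) :
    Nonempty (M ≃ₜ N) :=
  hF (isHCobordant_of_typeOneNine hU hW M N μ ν hμ hν)

/-! ### §3 Assembly from the leaf data (the parent's proof obligation, spelt out) -/

/-- **`exists_homeomorph_isEmpty_diffeomorph_four` along its own source.** GIVEN Wall's Thm. 2
(`hW`) and Freedman's h-cobordism theorem (`hF`), ANY pair of simply connected closed smooth
4-manifolds `Y`, `Z` (in `Type`) with `ℤ`-orientations `μ`, `ν` whose intersection forms are odd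
of type `(1, 9)` and which are not diffeomorphic is an exotic pair: homeomorphic by
`nonempty_homeomorph_of_typeOneNine` (Prop. (3.16)(ii), p. 160: classification of forms, Wall,
Freedman; unimodularity being the tree's theorem `isPerfPair_intersectionForm_four_of_compactSpace`)
and not diffeomorphic by hypothesis. Donaldson's `Y = ℂℙ² # 9ℂℙ²bar` (p. 159) and Dolgachev
surface `Z` (proof of Prop. (3.16)(ii), p. 160: simply connected, odd form of type `(1, 9)`;
Thm. (3.24), p. 163: not diffeomorphic to `Y`) are the printed witnesses of the data, whose formal
construction — with the `Γ`-invariant computation — is exactly what an unconditional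
`exists_homeomorph_isEmpty_diffeomorph_four_holds` along this source must supply (2026-08-15: the
former named-fact packaging of these hypotheses was merged back into that obligation, see the
module docstring). [cite: DonaldsonIrrationality1987, Prop. (3.16)(ii) p. 159 and Thm. (3.24) p. 163] -/
theorem exists_homeomorph_isEmpty_diffeomorph_four_of_donaldson1987
    (hW : isHCobordant_of_equivalent_intersectionForm)
    (hF : nonempty_homeomorph_of_isHCobordant_four.{0})
    (Y Z : Type) [TopologicalSpace Y] [T2Space Y] [SecondCountableTopology Y]
    [ChartedSpace (𝔼 4) Y] [CompactSpace Y] [IsManifold (𝓡 4) ∞ Y] [SimplyConnectedSpace Y]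
    [TopologicalSpace Z] [T2Space Z] [SecondCountableTopology Z] [ChartedSpace (𝔼 4) Z]
    [CompactSpace Z] [IsManifold (𝓡 4) ∞ Z] [SimplyConnectedSpace Z]
    (μ : HomologicalOrientation ℤ Y 4) (ν : HomologicalOrientation ℤ Z 4)
    (hμ : sigPos (Q⟦μ⟧).toQuadraticMap = 1 ∧ sigNeg (Q⟦μ⟧).toQuadraticMap = 9 ∧ (Q⟦μ⟧).IsOdd)
    (hν : sigPos (Q⟦ν⟧).toQuadraticMap = 1 ∧ sigNeg (Q⟦ν⟧).toQuadraticMap = 9 ∧ (Q⟦ν⟧).IsOdd)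
    (hne : IsEmpty (Y ≃ₘ⟮𝓡 4, 𝓡 4⟯ Z)) :
    exists_homeomorph_isEmpty_diffeomorph_four :=
  ⟨Y, Z, inferInstance, inferInstance, inferInstance, inferInstance, inferInstance, inferInstance,
    inferInstance, inferInstance, inferInstance, inferInstance, inferInstance, inferInstance,
    inferInstance, inferInstance,
    nonempty_homeomorph_of_typeOneNine (fun _ _ _ _ _ => isPerfPair_intersectionForm_four_of_compactSpace)
      hW hF Y Z μ ν hμ hν, hne⟩

/-- **Donaldson's counterexample to the smooth h-cobordism conjecture, WITHOUT Freedman**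
(p. 142: "So `Z` and `ℂℙ² # 9ℂℙ²bar` are h-cobordant nondiffeomorphic manifolds and they give a
counterexample to the 'h-cobordism conjecture' for smooth 4-manifolds"). GIVEN Wall's Thm. 2
(`hW`), any pair of simply connected closed smooth 4-manifolds in `Type` with odd intersection
forms of type `(1, 9)` and no diffeomorphism witnesses the tree's named fact
`exists_isHCobordant_isEmpty_diffeomorph_four` (**spc4.S16**, `HCobordism.lean`): h-cobordant by
`isHCobordant_of_typeOneNine` (unimodularity from `isPerfPair_intersectionForm_four_of_compactSpace`),
not diffeomorphic by hypothesis — for Donaldson's `(Y, Z)`, by Thm. (3.24). This is the printed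
inference; the sibling assembly `exists_isHCobordant_isEmpty_diffeomorph_four_of` goes through a
homeomorphism instead and so, fed by Akhmedov–Park, depends on Freedman.
[cite: DonaldsonIrrationality1987, p. 142 with Prop. (3.16)(ii) and Thm. (3.24)] -/
theorem exists_isHCobordant_isEmpty_diffeomorph_four_of_donaldson1987
    (hW : isHCobordant_of_equivalent_intersectionForm)
    (Y Z : Type) [TopologicalSpace Y] [T2Space Y] [SecondCountableTopology Y]
    [ChartedSpace (𝔼 4) Y] [CompactSpace Y] [IsManifold (𝓡 4) ∞ Y] [SimplyConnectedSpace Y]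
    [TopologicalSpace Z] [T2Space Z] [SecondCountableTopology Z] [ChartedSpace (𝔼 4) Z]
    [CompactSpace Z] [IsManifold (𝓡 4) ∞ Z] [SimplyConnectedSpace Z]
    (μ : HomologicalOrientation ℤ Y 4) (ν : HomologicalOrientation ℤ Z 4)
    (hμ : sigPos (Q⟦μ⟧).toQuadraticMap = 1 ∧ sigNeg (Q⟦μ⟧).toQuadraticMap = 9 ∧ (Q⟦μ⟧).IsOdd)
    (hν : sigPos (Q⟦ν⟧).toQuadraticMap = 1 ∧ sigNeg (Q⟦ν⟧).toQuadraticMap = 9 ∧ (Q⟦ν⟧).IsOdd)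
    (hne : IsEmpty (Y ≃ₘ⟮𝓡 4, 𝓡 4⟯ Z)) :
    exists_isHCobordant_isEmpty_diffeomorph_four :=
  ⟨Y, Z, inferInstance, inferInstance, inferInstance, inferInstance, inferInstance, inferInstance,
    inferInstance, inferInstance, inferInstance, inferInstance, inferInstance, inferInstance,
    inferInstance, inferInstance,
    isHCobordant_of_typeOneNine (fun _ _ _ _ _ => isPerfPair_intersectionForm_four_of_compactSpace)
      hW Y Z μ ν hμ hν, hne⟩

/-- **Trust-base comparison.** Along Donaldson's own source the h-cobordism counterexample
(**spc4.S16**) and the exotic pair (**B**) come from the SAME leaf data; the only extra input for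
(B) is Freedman: `(S16 from hW and the data)` and `(B from hW, hF and the data)` packaged together.
[cite: DonaldsonIrrationality1987, p. 142] -/
theorem exists_isHCobordant_and_exists_homeomorph_of_donaldson1987
    (hW : isHCobordant_of_equivalent_intersectionForm)
    (hF : nonempty_homeomorph_of_isHCobordant_four.{0})
    (Y Z : Type) [TopologicalSpace Y] [T2Space Y] [SecondCountableTopology Y]
    [ChartedSpace (𝔼 4) Y] [CompactSpace Y] [IsManifold (𝓡 4) ∞ Y] [SimplyConnectedSpace Y]
    [TopologicalSpace Z] [T2Space Z] [SecondCountableTopology Z] [ChartedSpace (𝔼 4) Z]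
    [CompactSpace Z] [IsManifold (𝓡 4) ∞ Z] [SimplyConnectedSpace Z]
    (μ : HomologicalOrientation ℤ Y 4) (ν : HomologicalOrientation ℤ Z 4)
    (hμ : sigPos (Q⟦μ⟧).toQuadraticMap = 1 ∧ sigNeg (Q⟦μ⟧).toQuadraticMap = 9 ∧ (Q⟦μ⟧).IsOdd)
    (hν : sigPos (Q⟦ν⟧).toQuadraticMap = 1 ∧ sigNeg (Q⟦ν⟧).toQuadraticMap = 9 ∧ (Q⟦ν⟧).IsOdd)
    (hne : IsEmpty (Y ≃ₘ⟮𝓡 4, 𝓡 4⟯ Z)) :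
    exists_isHCobordant_isEmpty_diffeomorph_four ∧ exists_homeomorph_isEmpty_diffeomorph_four :=
  ⟨exists_isHCobordant_isEmpty_diffeomorph_four_of_donaldson1987 hW Y Z μ ν hμ hν hne,
    exists_homeomorph_isEmpty_diffeomorph_four_of_donaldson1987 hW hF Y Z μ ν hμ hν hne⟩

end Literature.Topology.FourManifolds

end
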